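import Literature.MathematicalPhysics.QuantumFieldTheory.OSDistributionSpaceHolomorphicSemigroup
import Mathlib.Analysis.Calculus.Deriv.Star
import Mathlib.Analysis.InnerProductSpace.Adjoint
import HarnessLib

/-!
# The holomorphic semigroup `e^{-τH}` of an OS family, III: semigroup law, adjoints, contraction

Osterwalder–Schrader I (CMP 31 (1973)), §4.1, p. 92: "The family `T^τ = T^t V^s`, `τ = t + is`,
is a holomorphic semigroup for `Re τ > 0`, uniformly bounded and strongly continuous for
`Re τ ≥ 0`", with `V^s = e^{isH}` "the unitary representation of the time translation group".
For the operators `holoShiftH hE1 τ` (`e^{-τH}`, part II) this file proves exactly these clauses,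
each by transfer from the real axis through the identity theorem
(`Literature.Analysis.OperatorTheory.eqOn_closedHalfPlane_of_eqOn_ofReal`):

* `adjoint_holoShiftH` — `(e^{-τH})* = e^{-τ̄H}` (the Schwarz-reflected matrix element
  `τ ↦ conj S_{τ̄}(y, x)` is holomorphic and equals `S_τ(x, y)` on the real axis by the symmetry of
  `e^{-sH}`);
* `holoShiftH_add` — **the semigroup law** `e^{-(τ+τ')H} = e^{-τH} e^{-τ'H}` on `{Re ≥ 0}` (first
  for real `τ'`, in the variable `τ`; then in the variable `τ'`, using the adjoint);
* `norm_holoShiftH_apply_sq`, `opNorm_holoShiftH_le_one` — `‖e^{-τH}x‖² = ⟪x, e^{-2(Re τ)H} x⟫`,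
  hence **`‖e^{-τH}‖ ≤ 1`** ("uniformly bounded");
* `holoShiftH_mem_unitary` — **`e^{isH}` is unitary** (`Re τ = 0`);
* `continuousOn_holoShiftH_apply` — **strong continuity on `{Re τ ≥ 0}`**.

## References
* K. Osterwalder, R. Schrader, Axioms for Euclidean Green's functions, CMP 31 (1973), §4.1,
  p. 92 (the holomorphic semigroup `T^τ` and the unitary group `V^s = e^{isH}`).
-/

noncomputable section

open MeasureTheory Set Filter
open _root_.Topology
open scoped InnerProductSpace NNReal ComplexConjugate

-- CFC instance chain on `ℋ →L[ℂ] ℋ` (see `OSDistributionSpacePowers`).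
set_option synthInstance.maxHeartbeats 200000

namespace Literature.MathematicalPhysics.QuantumFieldTheory

variable {d : ℕ} [NeZero d]

section SchwingerFamily
open Literature.MathematicalPhysics.QuantumLattice (SchwingerFamily)
open Literature.MathematicalPhysics.QuantumLattice.SchwingerFamily
open Literature.MathematicalPhysics.QuantumLattice.SchwingerFamily.OSSpace
open Literature.Analysis.OperatorTheory

variable {𝔖 : SchwingerFamily (EuclideanSpace ℝ (Fin d))} {hE2 : 𝔖.IsOSReflectionPositive}

/-! ## Holomorphy of reflected and translated matrix elements -/

/-- Schwarz reflection preserves holomorphy on the right half-plane: if `f` is holomorphic on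
`{Re > 0}` then so is `τ ↦ conj (f (conj τ))`. [folklore] -/
theorem differentiableOn_conj_comp_conj {f : ℂ → ℂ} (hf : DifferentiableOn ℂ f {z : ℂ | 0 < z.re}) :
    DifferentiableOn ℂ (fun τ => conj (f (conj τ))) {z : ℂ | 0 < z.re} := by
  intro τ hτ
  have hU : IsOpen {z : ℂ | 0 < z.re} := isOpen_lt continuous_const Complex.continuous_re
  have hτ' : conj τ ∈ {z : ℂ | 0 < z.re} := by simpa using hτ
  have hd : DifferentiableAt ℂ f (conj τ) := hf.differentiableAt (hU.mem_nhds hτ')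
  have := hd.conj_conj
  rw [Complex.conj_conj] at this
  exact this.differentiableWithinAt

/-- Schwarz reflection preserves continuity on the closed right half-plane. [folklore] -/
theorem continuousOn_conj_comp_conj {f : ℂ → ℂ} (hf : ContinuousOn f {z : ℂ | 0 ≤ z.re}) :
    ContinuousOn (fun τ => conj (f (conj τ))) {z : ℂ | 0 ≤ z.re} := by
  refine Complex.continuous_conj.comp_continuousOn (hf.comp Complex.continuous_conj.continuousOn ?_)
  intro τ hτ
  simpa using hτ

/-- Translation by `c` with `Re c ≥ 0` preserves holomorphy on the right half-plane. [folklore] -/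
theorem differentiableOn_comp_add {f : ℂ → ℂ} (hf : DifferentiableOn ℂ f {z : ℂ | 0 < z.re}) {c : ℂ}
    (hc : 0 ≤ c.re) : DifferentiableOn ℂ (fun τ => f (c + τ)) {z : ℂ | 0 < z.re} :=
  hf.comp ((differentiableOn_const c).add differentiableOn_id) fun τ hτ => by
    simp only [mem_setOf_eq, Complex.add_re] at hτ ⊢; linarith

/-- Translation by `c` with `Re c ≥ 0` preserves continuity on the closed right half-plane. [folklore] -/
theorem continuousOn_comp_add {f : ℂ → ℂ} (hf : ContinuousOn f {z : ℂ | 0 ≤ z.re}) {c : ℂ}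
    (hc : 0 ≤ c.re) : ContinuousOn (fun τ => f (c + τ)) {z : ℂ | 0 ≤ z.re} :=
  hf.comp (continuousOn_const.add continuousOn_id) fun τ hτ => by
    simp only [mem_setOf_eq, Complex.add_re] at hτ ⊢; linarith

/-! ## The adjoint: `(e^{-τH})* = e^{-τ̄H}` -/

/-- **Reflection symmetry of the matrix elements**: `conj S_τ(y, x) = S_{τ̄}(x, y)` for
`Re τ ≥ 0` (on the real axis this is the symmetry `⟪e^{-sH}x, y⟫ = ⟪x, e^{-sH}y⟫`; both sides of
`conj S_{σ̄}(y, x) = S_σ(x, y)` are holomorphic in `σ`). [folklore] -/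
theorem _root_.Literature.MathematicalPhysics.QuantumLattice.SchwingerFamily.OSSpace.conj_matrixElemC (hE1 : 𝔖.IsEuclideanCovariant) (x y : OSHilbert 𝔖 hE2) {τ : ℂ} (hτ : 0 ≤ τ.re) :
    conj (matrixElemC hE1 y x τ) = matrixElemC hE1 x y (conj τ) := by
  have key : ∀ {σ : ℂ}, 0 ≤ σ.re → conj (matrixElemC hE1 y x (conj σ)) = matrixElemC hE1 x y σ := by
    intro σ hσ
    refine eq_of_eqOn_ofReal (f := fun σ => conj (matrixElemC hE1 y x (conj σ)))
      (differentiableOn_conj_comp_conj (differentiableOn_matrixElemC hE1 y x))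
      (differentiableOn_matrixElemC hE1 x y)
      (continuousOn_conj_comp_conj (continuousOn_matrixElemC hE1 y x))
      (continuousOn_matrixElemC hE1 x y) (fun s hs => ?_) hσ
    simp only [Complex.conj_ofReal, matrixElemC_ofReal hE1 _ _ hs]
    rw [← inner_conj_symm, starRingEnd_self_apply, inner_shiftH_left hE1 hs.le]
  have h := key (σ := conj τ) (by simpa using hτ)
  rwa [Complex.conj_conj] at h

/-- **The adjoint of `e^{-τH}` is `e^{-τ̄H}`** (`Re τ ≥ 0`). [cite: OsterwalderSchraderCMP1973, §4.1 p. 92] -/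
theorem _root_.Literature.MathematicalPhysics.QuantumLattice.SchwingerFamily.OSSpace.adjoint_holoShiftH (hE1 : 𝔖.IsEuclideanCovariant) {τ : ℂ} (hτ : 0 ≤ τ.re) :
    ContinuousLinearMap.adjoint (holoShiftH (hE2 := hE2) hE1 τ) = holoShiftH hE1 (conj τ) := by
  refine ContinuousLinearMap.ext fun y => ext_inner_left ℂ fun x => ?_
  rw [ContinuousLinearMap.adjoint_inner_right, ← inner_conj_symm, inner_holoShiftH hE1 hτ,
    conj_matrixElemC hE1 x y hτ, inner_holoShiftH hE1 (by simpa using hτ)]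

/-- `⟪e^{-τH} x, y⟫ = ⟪x, e^{-τ̄H} y⟫`. [folklore] -/
theorem _root_.Literature.MathematicalPhysics.QuantumLattice.SchwingerFamily.OSSpace.inner_holoShiftH_left (hE1 : 𝔖.IsEuclideanCovariant) {τ : ℂ} (hτ : 0 ≤ τ.re) (x y : OSHilbert 𝔖 hE2) :
    ⟪holoShiftH (hE2 := hE2) hE1 τ x, y⟫_ℂ = ⟪x, holoShiftH hE1 (conj τ) y⟫_ℂ := by
  rw [← adjoint_holoShiftH hE1 hτ, ContinuousLinearMap.adjoint_inner_right]

/-! ## The semigroup law -/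

/-- The semigroup law with a real second time: `e^{-(τ+s)H} = e^{-τH} e^{-sH}`, `s > 0`,
`Re τ ≥ 0` (transfer in the variable `τ`). [folklore] -/
theorem _root_.Literature.MathematicalPhysics.QuantumLattice.SchwingerFamily.OSSpace.holoShiftH_add_ofReal (hE1 : 𝔖.IsEuclideanCovariant) {τ : ℂ} (hτ : 0 ≤ τ.re) {s : ℝ} (hs : 0 < s) :
    holoShiftH (hE2 := hE2) hE1 (τ + s) = holoShiftH hE1 τ * holoShiftH hE1 s := by
  refine ContinuousLinearMap.ext fun y => ext_inner_left ℂ fun x => ?_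
  have hτs : 0 ≤ (τ + s).re := by simp only [Complex.add_re, Complex.ofReal_re]; linarith
  rw [inner_holoShiftH hE1 hτs, mul_apply_eq_comp, inner_holoShiftH hE1 hτ, holoShiftH_ofReal hE1 hs]
  -- transfer in `τ`: `σ ↦ S_{σ+s}(x, y)` vs `σ ↦ S_σ(x, e^{-sH} y)`
  have hs0 : 0 ≤ (s : ℂ).re := by simpa using hs.le
  refine eq_of_eqOn_ofReal (f := fun σ => matrixElemC hE1 x y (σ + s))
    (g := fun σ => matrixElemC hE1 x (shiftH hE2 s y) σ) ?_ (differentiableOn_matrixElemC hE1 _ _) ?_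
    (continuousOn_matrixElemC hE1 _ _) (fun r hr => ?_) hτ
  · have := differentiableOn_comp_add (differentiableOn_matrixElemC hE1 x y) hs0
    simpa only [add_comm] using this
  · have := continuousOn_comp_add (continuousOn_matrixElemC hE1 x y) hs0
    simpa only [add_comm] using this
  · have hrs : ((r : ℂ) + s) = ((r + s : ℝ) : ℂ) := by push_cast; ring
    simp only [hrs, matrixElemC_ofReal hE1 _ _ (add_pos hr hs), matrixElemC_ofReal hE1 _ _ hr,
      shiftH_add_apply hE1 hr.le hs.le]

/-- **The semigroup law** `e^{-(τ+τ')H} = e^{-τH} e^{-τ'H}` for `Re τ, Re τ' ≥ 0`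
(Osterwalder–Schrader I (1973), p. 92: "holomorphic semigroup"). Transfer in the variable `τ'`,
the function `τ' ↦ ⟪x, e^{-τH} e^{-τ'H} y⟫ = S_{τ'}(e^{-τ̄H} x, y)` being holomorphic. [cite: OsterwalderSchraderCMP1973, §4.1 p. 92] -/
theorem _root_.Literature.MathematicalPhysics.QuantumLattice.SchwingerFamily.OSSpace.holoShiftH_add (hE1 : 𝔖.IsEuclideanCovariant) {τ τ' : ℂ} (hτ : 0 ≤ τ.re) (hτ' : 0 ≤ τ'.re) :
    holoShiftH (hE2 := hE2) hE1 (τ + τ') = holoShiftH hE1 τ * holoShiftH hE1 τ' := by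
  refine ContinuousLinearMap.ext fun y => ext_inner_left ℂ fun x => ?_
  have hsum : 0 ≤ (τ + τ').re := by simp only [Complex.add_re]; linarith
  rw [inner_holoShiftH hE1 hsum, mul_apply_eq_comp, ← ContinuousLinearMap.adjoint_inner_left,
    adjoint_holoShiftH hE1 hτ, inner_holoShiftH hE1 hτ']
  refine eq_of_eqOn_ofReal (f := fun σ => matrixElemC hE1 x y (τ + σ))
    (g := fun σ => matrixElemC hE1 (holoShiftH hE1 (conj τ) x) y σ)
    (differentiableOn_comp_add (differentiableOn_matrixElemC hE1 x y) hτ)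
    (differentiableOn_matrixElemC hE1 _ _)
    (continuousOn_comp_add (continuousOn_matrixElemC hE1 x y) hτ)
    (continuousOn_matrixElemC hE1 _ _) (fun s hs => ?_) hτ'
  -- on the real axis: part `holoShiftH_add_ofReal`
  have hτs : 0 ≤ (τ + s).re := by simp only [Complex.add_re, Complex.ofReal_re]; linarith
  have hs0 : 0 ≤ (s : ℂ).re := by simpa using hs.le
  show matrixElemC hE1 x y (τ + s) = matrixElemC hE1 (holoShiftH hE1 (conj τ) x) y s
  rw [← inner_holoShiftH hE1 hτs, holoShiftH_add_ofReal hE1 hτ hs, mul_apply_eq_comp,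
    ← ContinuousLinearMap.adjoint_inner_left, adjoint_holoShiftH hE1 hτ, inner_holoShiftH hE1 hs0]

/-! ## Contraction, unitarity, strong continuity -/

/-- **`‖e^{-τH} x‖² = ⟪x, e^{-2(Re τ)H} x⟫`** for `Re τ ≥ 0` (`(e^{-τH})* e^{-τH} = e^{-(τ̄+τ)H}`). [folklore] -/
theorem _root_.Literature.MathematicalPhysics.QuantumLattice.SchwingerFamily.OSSpace.norm_holoShiftH_apply_sq (hE1 : 𝔖.IsEuclideanCovariant) {τ : ℂ} (hτ : 0 ≤ τ.re) (x : OSHilbert 𝔖 hE2) :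
    ‖holoShiftH (hE2 := hE2) hE1 τ x‖ ^ 2 = RCLike.re ⟪x, holoShiftH hE1 ((2 * τ.re : ℝ) : ℂ) x⟫_ℂ := by
  have hconj : 0 ≤ (conj τ).re := by simpa using hτ
  have h2 : ((2 * τ.re : ℝ) : ℂ) = conj τ + τ := by
    rw [add_comm, Complex.add_conj]
  rw [← inner_self_eq_norm_sq (𝕜 := ℂ), inner_holoShiftH_left hE1 hτ, ← mul_apply_eq_comp,
    ← holoShiftH_add hE1 hconj hτ, h2]

/-- **`e^{-τH}` is a contraction**: `‖e^{-τH} x‖ ≤ ‖x‖` for `Re τ ≥ 0`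
(Osterwalder–Schrader I (1973), p. 92: "uniformly bounded … for `Re τ ≥ 0`"). [cite: OsterwalderSchraderCMP1973, §4.1 p. 92] -/
theorem _root_.Literature.MathematicalPhysics.QuantumLattice.SchwingerFamily.OSSpace.norm_holoShiftH_apply_le (hE1 : 𝔖.IsEuclideanCovariant) {τ : ℂ} (hτ : 0 ≤ τ.re) (x : OSHilbert 𝔖 hE2) :
    ‖holoShiftH (hE2 := hE2) hE1 τ x‖ ≤ ‖x‖ := by
  have hsq : ‖holoShiftH (hE2 := hE2) hE1 τ x‖ ^ 2 ≤ ‖x‖ ^ 2 := by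
    rw [norm_holoShiftH_apply_sq hE1 hτ]
    rcases (mul_nonneg zero_le_two hτ).eq_or_lt with h0 | hpos
    · -- `Re τ = 0`: `e^{-0H} = 1`
      rw [← h0, Complex.ofReal_zero, holoShiftH_zero hE1, one_apply_eq_self, inner_self_eq_norm_sq]
    · rw [holoShiftH_ofReal hE1 hpos]
      calc RCLike.re ⟪x, shiftH hE2 (2 * τ.re) x⟫_ℂ ≤ ‖⟪x, shiftH hE2 (2 * τ.re) x⟫_ℂ‖ := RCLike.re_le_norm _
        _ ≤ ‖x‖ * ‖shiftH hE2 (2 * τ.re) x‖ := norm_inner_le_norm _ _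
        _ ≤ ‖x‖ * ‖x‖ := by gcongr; exact norm_shiftH_le hE1 _ _
        _ = ‖x‖ ^ 2 := (sq ‖x‖).symm
  exact (pow_le_pow_iff_left₀ (norm_nonneg _) (norm_nonneg _) two_ne_zero).1 hsq

/-- **`‖e^{-τH}‖ ≤ 1`** for `Re τ ≥ 0`. [cite: OsterwalderSchraderCMP1973, §4.1 p. 92] -/
theorem _root_.Literature.MathematicalPhysics.QuantumLattice.SchwingerFamily.OSSpace.opNorm_holoShiftH_le_one (hE1 : 𝔖.IsEuclideanCovariant) {τ : ℂ} (hτ : 0 ≤ τ.re) :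
    ‖holoShiftH (hE2 := hE2) hE1 τ‖ ≤ 1 :=
  ContinuousLinearMap.opNorm_le_bound _ zero_le_one fun x => by
    simpa using norm_holoShiftH_apply_le hE1 hτ x

/-- On the imaginary axis `e^{-τH}` is an isometry: `‖e^{isH} x‖ = ‖x‖`. [folklore] -/
theorem _root_.Literature.MathematicalPhysics.QuantumLattice.SchwingerFamily.OSSpace.norm_holoShiftH_apply_of_re_eq_zero (hE1 : 𝔖.IsEuclideanCovariant) {τ : ℂ} (hτ : τ.re = 0) (x : OSHilbert 𝔖 hE2) :
    ‖holoShiftH (hE2 := hE2) hE1 τ x‖ = ‖x‖ := by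
  have hsq : ‖holoShiftH (hE2 := hE2) hE1 τ x‖ ^ 2 = ‖x‖ ^ 2 := by
    rw [norm_holoShiftH_apply_sq hE1 hτ.ge, hτ, mul_zero, Complex.ofReal_zero, holoShiftH_zero hE1,
      one_apply_eq_self, inner_self_eq_norm_sq]
  exact (pow_left_inj₀ (norm_nonneg _) (norm_nonneg _) two_ne_zero).1 hsq

/-- **`e^{isH}` is unitary**: for `Re τ = 0`, `holoShiftH τ` lies in the unitary group of `ℋ`
(`(e^{-τH})* e^{-τH} = e^{-τH} (e^{-τH})* = e^{-0H} = 1`; Osterwalder–Schrader I (1973), p. 92: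
"the unitary representation of the time translation group"). [cite: OsterwalderSchraderCMP1973, §4.1 p. 92] -/
theorem _root_.Literature.MathematicalPhysics.QuantumLattice.SchwingerFamily.OSSpace.holoShiftH_mem_unitary (hE1 : 𝔖.IsEuclideanCovariant) {τ : ℂ} (hτ : τ.re = 0) :
    holoShiftH (hE2 := hE2) hE1 τ ∈ unitary (OSHilbert 𝔖 hE2 →L[ℂ] OSHilbert 𝔖 hE2) := by
  have hτ0 : 0 ≤ τ.re := hτ.ge
  have hconj : 0 ≤ (conj τ).re := by simpa using hτ0
  have hsum : conj τ + τ = 0 := by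
    rw [add_comm, Complex.add_conj, hτ]; simp
  have hsum' : τ + conj τ = 0 := by rw [add_comm, hsum]
  rw [Unitary.mem_iff, ContinuousLinearMap.star_eq_adjoint, adjoint_holoShiftH hE1 hτ0]
  constructor
  · rw [← holoShiftH_add hE1 hconj hτ0, hsum, holoShiftH_zero hE1]
  · rw [← holoShiftH_add hE1 hτ0 hconj, hsum', holoShiftH_zero hE1]

/-- **Strong continuity of `e^{-τH}` on `{Re τ ≥ 0}`** (Osterwalder–Schrader I (1973), p. 92:
"strongly continuous for `Re τ ≥ 0`"): for each `x`, `τ ↦ e^{-τH} x` is continuous on the closed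
half-plane. Proof: `‖e^{-τH}x − e^{-τ₀H}x‖² = ‖e^{-τH}x‖² − 2 Re⟪e^{-τ₀H}x, e^{-τH}x⟫ + ‖e^{-τ₀H}x‖²`,
where `‖e^{-τH}x‖² = Re ⟪x, e^{-2(Re τ)H}x⟫` and `⟪e^{-τ₀H}x, e^{-τH}x⟫ = S_τ(e^{-τ₀H}x, x)` are
continuous in `τ` (weak continuity). [cite: OsterwalderSchraderCMP1973, §4.1 p. 92] -/
theorem _root_.Literature.MathematicalPhysics.QuantumLattice.SchwingerFamily.OSSpace.continuousOn_holoShiftH_apply (hE1 : 𝔖.IsEuclideanCovariant) (x : OSHilbert 𝔖 hE2) :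
    ContinuousOn (fun τ => holoShiftH (hE2 := hE2) hE1 τ x) {τ : ℂ | 0 ≤ τ.re} := by
  intro τ₀ hτ₀
  set T := fun τ => holoShiftH (hE2 := hE2) hE1 τ with hT
  -- the two continuous scalar quantities
  have hg : Continuous fun τ : ℂ => ((2 * τ.re : ℝ) : ℂ) := by fun_prop
  have hmap : MapsTo (fun τ : ℂ => ((2 * τ.re : ℝ) : ℂ)) {τ : ℂ | 0 ≤ τ.re} {τ : ℂ | 0 ≤ τ.re} := by
    intro τ hτ
    simp only [mem_setOf_eq, Complex.ofReal_re] at hτ ⊢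
    linarith
  have hA : ContinuousWithinAt (fun τ : ℂ => RCLike.re ⟪x, T ((2 * τ.re : ℝ) : ℂ) x⟫_ℂ)
      {τ : ℂ | 0 ≤ τ.re} τ₀ := by
    have hc := continuousOn_inner_holoShiftH (hE2 := hE2) hE1 x x
    have h1 : ContinuousWithinAt (fun σ : ℂ => RCLike.re ⟪x, T σ x⟫_ℂ) {τ : ℂ | 0 ≤ τ.re}
        ((fun τ : ℂ => ((2 * τ.re : ℝ) : ℂ)) τ₀) :=
      RCLike.continuous_re.continuousAt.comp_continuousWithinAt (hc _ (hmap hτ₀))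
    exact ContinuousWithinAt.comp (g := fun σ : ℂ => RCLike.re ⟪x, T σ x⟫_ℂ)
      (f := fun τ : ℂ => ((2 * τ.re : ℝ) : ℂ)) h1 hg.continuousWithinAt hmap
  have hB : ContinuousWithinAt (fun τ : ℂ => ⟪T τ₀ x, T τ x⟫_ℂ) {τ : ℂ | 0 ≤ τ.re} τ₀ :=
    continuousOn_inner_holoShiftH (hE2 := hE2) hE1 (T τ₀ x) x τ₀ hτ₀
  -- the squared distance tends to `0`
  have hdist : ∀ τ ∈ {τ : ℂ | 0 ≤ τ.re}, ‖T τ x - T τ₀ x‖ ^ 2 =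
      RCLike.re ⟪x, T ((2 * τ.re : ℝ) : ℂ) x⟫_ℂ - 2 * RCLike.re ⟪T τ₀ x, T τ x⟫_ℂ + ‖T τ₀ x‖ ^ 2 := by
    intro τ hτ
    rw [@norm_sub_sq ℂ, norm_holoShiftH_apply_sq hE1 hτ, ← inner_conj_symm (T τ x) (T τ₀ x),
      RCLike.conj_re]
  have hlim : Tendsto (fun τ => ‖T τ x - T τ₀ x‖ ^ 2) (𝓝[{τ : ℂ | 0 ≤ τ.re}] τ₀) (𝓝 0) := by
    have hF : ContinuousWithinAt (fun τ : ℂ => RCLike.re ⟪x, T ((2 * τ.re : ℝ) : ℂ) x⟫_ℂ -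
        2 * RCLike.re ⟪T τ₀ x, T τ x⟫_ℂ + ‖T τ₀ x‖ ^ 2) {τ : ℂ | 0 ≤ τ.re} τ₀ :=
      (hA.sub (continuousWithinAt_const.mul
        (RCLike.continuous_re.continuousAt.comp_continuousWithinAt hB))).add continuousWithinAt_const
    have h0 : RCLike.re ⟪x, T ((2 * τ₀.re : ℝ) : ℂ) x⟫_ℂ - 2 * RCLike.re ⟪T τ₀ x, T τ₀ x⟫_ℂ +
        ‖T τ₀ x‖ ^ 2 = 0 := by
      rw [inner_self_eq_norm_sq, ← norm_holoShiftH_apply_sq hE1 hτ₀]; ring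
    have hten := hF.tendsto
    simp only [h0] at hten
    exact hten.congr' (eventually_nhdsWithin_of_forall fun τ hτ => (hdist τ hτ).symm)
  -- conclude
  rw [ContinuousWithinAt, tendsto_iff_norm_sub_tendsto_zero]
  have := hlim.sqrt
  simpa [Real.sqrt_sq (norm_nonneg _)] using this

end SchwingerFamily

end Literature.MathematicalPhysics.QuantumFieldTheory
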